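import Mathlib
import Summits.ValiantsHypothesis.ValiantsHypothesis.Theorems.NewtonUnitEquationsDissociatedUniformTotalsLawTernaryData0
import Summits.ValiantsHypothesis.ValiantsHypothesis.Theorems.NewtonUnitEquationsDissociatedUniformTotalsLawTernaryData1
import Summits.ValiantsHypothesis.ValiantsHypothesis.Theorems.NewtonUnitEquationsDissociatedUniformTotalsLawTernaryData2
import HarnessLib

/-!
# Crux `NewtonUnitEquations.DissociatedUniform` (stmt-ValiantsHypothesis-5905): the constant `C = 1` of the typed GENERAL totals law is FALSE — a ternary design with `T(9, ℤ/3) = 91 > 90`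

Memo `Cruxes/DissociatedUniform/NOTES-t1.md` §1 recorded, as the constant of record of the conjecture-grade general totals law
`TotalsLawN.TotalsLawGeneral C : ∀ n G c, T ≤ C·(n+1)·|G|²` (memo `NOTES-d1g3.md` §3: data `T(n) ≈ (n-1)·q²`), the value `C = 1`.
The binary row (`…TotalsLawBinary`: `T(n, ℤ/2) ≤ 4n`) confirms it for `|G| ≤ 2`.  THIS FILE REFUTES IT AT `|G| = 3`:
`not_totalsLawGeneral_one : ¬ TotalsLawGeneral 1`, by the explicit ternary design `Ternary.P9 : Fin 9 → ℤ/3 → ℤ²` (this seat's local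
annealing + greedy extension; memo `NOTES-t1g3.md`) whose three classes have `32 + 31 + 28 = 91 > 90 = 1·(9+1)·3²` hull vertices,
each certified in the kernel by a dynamic-programming vertex certificate (`…TotalsLawCert`, data `…TotalsLawTernaryData0/1/2`).
Consequently any valid constant of the general law is `≥ 2` (`two_le_of_totalsLawGeneral`); numerically the ternary rows grow like
`≈ 12·n` (`= 2q(q-1)·n`?), not `9·n`.  The LAW ITSELF (some `C`; conjecturally `C = 2` still fits all data), the `n = 3` law and
`stub_smallShadow` stay OPEN; VP ≠ VNP is not touched.
[folklore: extreme points of the hull of a finite set lie in the set]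
-/

set_option linter.dupNamespace false -- `ValiantsHypothesis.ValiantsHypothesis` (summit = problem) in every name

open scoped BigOperators

namespace Summit.ValiantsHypothesis.ValiantsHypothesis.Theorems.NewtonUnitEquationsDissociatedUniform

namespace TotalsLawN

open Cert Ternary

/-- **`T ≥ 91`** for the ternary design `curves P9` (`9` coordinates over `ℤ/3`): the three classes carry at least `32`, `31`, `28`
certified hull vertices. [folklore] -/
theorem le_totalVert_P9 : 91 ≤ totalVert (curves P9) := by
  unfold totalVert
  have h3 : ∑ s : ZMod 3, classVert (curves P9) s =
      classVert (curves P9) 0 + classVert (curves P9) 1 + classVert (curves P9) 2 := Fin.sum_univ_three _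
  rw [h3]
  have h0 := le_classVert0
  have h1 := le_classVert1
  have h2 := le_classVert2
  omega

/-- **The constant `C = 1` of the typed general totals law is false.**  `TotalsLawGeneral 1` would give
`T ≤ 1·(9+1)·|ℤ/3|² = 90` for the ternary design `curves P9`, whose total is `≥ 91`. -/
theorem not_totalsLawGeneral_one : ¬ TotalsLawGeneral 1 := by
  intro h
  have h9 := h 9 (ZMod 3) (curves P9)
  rw [ZMod.card] at h9
  have h91 := le_totalVert_P9
  norm_num at h9
  omega

/-- **Any valid constant of the general totals law is at least `2`.** -/
theorem two_le_of_totalsLawGeneral {C : ℕ} (h : TotalsLawGeneral C) : 2 ≤ C := by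
  have h9 := h 9 (ZMod 3) (curves P9)
  rw [ZMod.card] at h9
  have h91 := le_totalVert_P9
  by_contra hC
  have hC' : C ≤ 1 := by omega
  have : C * (9 + 1) * 3 ^ 2 ≤ 1 * (9 + 1) * 3 ^ 2 := by gcongr
  norm_num at this
  omega

end TotalsLawN

end Summit.ValiantsHypothesis.ValiantsHypothesis.Theorems.NewtonUnitEquationsDissociatedUniform
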